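import Literature.MathematicalPhysics.QuantumFieldTheory.Balaban1983to89.B9Eq349DPBlockDecayWindow
import Literature.MathematicalPhysics.QuantumFieldTheory.Balaban1983to89.B9Eq389CutoffTailFromBlockDecay

/-!
# `Balaban1983to89.B9Eq349PBlockDecayWindow` — T. Bałaban, *Propagators for lattice gauge theories in a background field*, Commun. Math. Phys. **99**
# (1985) 389–434 [Balaban1985BackgroundPropagators] (3.25)–(3.26) pp. 394–395 with Thm 3.11 p. 416 and (3.49) p. 399: **THE SITES → SITES TWINS OF
# `B9Eq349DPBlockDecayWindow` §2 AND `B9Eq349KWAssemblySmallField` — block decay of `P(U) = 1 − R(U) = G′(U)Q̃′(U)†c(U)Q̃′(U)G′(U)` between the fine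
# site blocks at every background of the window: (§1) from the scalar letters with `∃ C` before the volume and `U`, (§2) `∃ ε₀ > 0, κ > 0, C ≥ 0`
# first, nothing displayed but the chain's standing conventions** — the `hdec` letter ne9-leaf-05's (K6T) consumes at a background (their W-4, journal
# 2026-08-23 l.53479: «YES, WANTED — … the SITES→SITES block decay of P(U) = 1 − R(U) …»); route R2′ STEP B8′, road B8″ of the pub-balaban NE9 chain

statement-level skeleton of published theorems with citation tags; proofs where landed; nothing here is a claim about the Yang–Mills mass gap

CITATION HEADER (lean-in-tree rule).  Audit cell `pub-balaban`, sub-cell `t4`, BINDER row NE9; filed by NE9 formalisation-swarm LEAF PROVER 01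
(`b2b-balaban-t4-ne9-formalise-leaf-01`, gen 85), composing BY NAME exactly as `B9Eq349DPBlockDecayWindow` (§1 = its §2's chain: (S3c) with the constant
displayed → `B9Eq349GreenPerturbedBlockDecay` §1 → (S3b) with (S3e-Q)'s `Q`-letters → (S3d) → (S3f)'s SITES → SITES letter
`norm_block_comp_oneSubR_comp_block_le`) and as `B9Eq349KWAssemblySmallField` (§2: ne9-leaf-06's `exists_flatc_bound` + continuity at `ε = 0`), and ne9-leaf-05 g76's (K6T)
`B9Eq389CutoffTailFromBlockDecay.norm_mul_apply_le_of_block_decay` (p366419 ✓; the junction corollary); the proofs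
are the twins' with the last step swapped (one file per consumer shape).  ROUTE LOCUS: `t4/ROUTES-NE9.md` v13.37–v13.42 §L1.2 ADDENDUM (ii) road B8″;
ne9-leaf-05 g76's (β) census l.53416 ∕ W-4 l.53479.  Source READ [Balaban1985BackgroundPropagators]: p. 394 (3.25), p. 395 (3.26), p. 399 (3.49), p. 409
(3.89), p. 416 Thm 3.11.  NOTHING of print's estimates is asserted; the rate and `ε₀` are the ROUTE's, UNVALUED ∕ not in closed form.

WHAT IS PROVED (sorry-free; proof lane — no `def`; [folklore] compositions BY NAME + elementary real analysis).
* §1 **`exists_block_decay_oneSubR_window`** — the scalar letters∕windows of `exists_block_decay_DP_window` ⟹ `∃ C ≥ 0, ∀ m, ∀ U (window), ∀ P^S, ∀ y₀ y₁: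
  ‖P^S_{y₁} ∘ toCLM(1 − R(U)) ∘ P^S_{y₀}‖ ≤ C·e^{−(κ∕8)·d_m(y₀,y₁)}`.
* §2 **`exists_oneSubR_decay_of_small_background`** — structure letters only ⟹ `∃ ε₀ κ C, 0 < ε₀ ∧ 0 < κ ∧ 0 ≤ C ∧ ∀ m, ∀ U (U ∈ U1, ‖U − 1‖ ≤ ε₀, hRS), ∀ P^S,
  ∀ y₀ y₁: ‖P^S_{y₁} ∘ toCLM(1 − R(U)) ∘ P^S_{y₀}‖ ≤ C·e^{−κ·d_m(y₀,y₁)}`; **`exists_cutoffTail_oneSubR_of_small_background`** — the JUNCTION into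
  ne9-leaf-05's (K6T) `norm_mul_apply_le_of_block_decay` by `exact`: `‖M((1 − R(U))f)‖ ≤ C·K_{d+1}(κ∕2)·e^{−(κ∕2)r₀}·‖f‖` for cut-off multipliers and
  supported `f` (S-P6′(β)'s `hτ` at a background).
HONEST SCOPE.  As the twins: NO number, NO window adjudicated in §1, `ε₀` by continuity in §2; NOT print's Thm 3.11; NOT NE9 (cell pub-balaban: NE9 NOT
PRINTED ∕ NOT PROVED; «NE9 ⇐ the named binders»; row WALLED ON A MODEL (O-NE9-1; #5 UNRULED); spine PROVED 0∕9; rung (B)+1 on a finite T⁴ — NOT infinite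
volume, NOT mass gap, NOT Clay; HONEST DEPENDENCY: continuum YM on T⁴ ⇐ BetaPertH ∧ nine spine estimates (0/9 proved); BetaPertH ⇐ (D1) ∧ (D4) ∧ CAP+tail;
G-an2-4 gates asym, D1 and NE2/3/4).  NEW file importing `B9Eq349DPBlockDecayWindow` and (K6T) `B9Eq389CutoffTailFromBlockDecay`; nothing modified.  Net new unproved facts: 0.
-/

noncomputable section
set_option autoImplicit false
open scoped InnerProductSpace ComplexConjugate BigOperators Topology
open Filter

namespace Literature.MathematicalPhysics.QuantumFieldTheory.Balaban1983to89.B9Eq349PBlockDecayWindow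
open B4Sect5Torus (TSite tdist tdist_nonneg)
open B4Sect5Proof (latticeConst latticeConst_nonneg)
open B9SectCLatticeCarrier (Bond bpos btgt)
open B9Eq311L2Pairing (WL2)
open B9Eq319QprimeTorus (fineP blockCoord)
open B11Eq103H1Complex (SiteL2K BondL2K covDerivL2K greenK)
open B7Prop1Explicit (U1)
open B9Eq310HessianOperator (adTransportW)
open B9Eq326OperatorAssembly (QprimeW RofU)
open B9Eq3119DeltaPiCarrier (laplacePrimeA GpOfU)
open B9Eq315QTorusOnto (liftSite)
open B5Torus145Decay (torusKernel145M)
open B9Thm311DeltaPrimeA (laplacePrimeA_pos_of_hRS)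
open B9Eq325ProjFormula (QGGQ_pos)
open B9Eq384RemainderLetters (hRS_one)
open B9Eq349BlockMultipliers (exists_block_clm_family sum_block_apply block_comp_self)
open B9Eq349BlockDecayAlgebra (decay_mono_rate)
open B9Eq349QtildeBlockLetters (point_comp_Qtilde_comp_block_eq_zero block_comp_adjoint_Qtilde_comp_point_eq_zero
  norm_point_comp_Qtilde_comp_block_le norm_point_comp_Qtilde_sub_comp_block_le norm_block_comp_adjoint_comp_point_le)
open B9Eq349QGGQPerturbationLetters (norm_block_QGGQ_sub_le_torus)
open B9Eq349GreenPerturbedBlockDecay (norm_block_comp_GpOfU_sub_flat_comp_block_le)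
open B9Eq349PerturbedQGGQInvBlockDecay (norm_point_block_greenK_le_of_window)
open B9Eq349DPBlockDecayLetters (norm_block_comp_oneSubR_comp_block_le)
open B9Eq349FlatQGGQInvKernel (exists_flatc_bound)
open B9Eq349DPBlockDecayWindow (norm_block_comp_GpOfU_comp_block_le_circle)
open B9Eq389CutoffTailFromBlockDecay (norm_mul_apply_le_of_block_decay)

/-! ## §1 The window theorem, sites → sites: `hdec(U)` for `P(U) = 1 − R(U)` from the scalar letters, `∃ C` before the volume and the background -/

section Window

variable {d : ℕ} {L : ℕ} [NeZero L] {𝔸 : Type*} [NormedRing 𝔸] [NormedAlgebra ℂ 𝔸] [NormOneClass 𝔸]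
  {W : Type*} [NormedAddCommGroup W] [InnerProductSpace ℂ W] [FiniteDimensional ℂ W] {φ : W ≃ₗ[ℂ] 𝔸} {Mφ Mφ' : ℝ}
  (hφ : ∀ w, ‖φ w‖ ≤ Mφ * ‖w‖) (hφ' : ∀ X, ‖φ.symm X‖ ≤ Mφ' * ‖X‖) (hMφ : 0 ≤ Mφ) (hMφ' : 0 ≤ Mφ')
  {c₀ : ℝ} [Fact (0 < c₀)] {η : ℝ} (hη : 0 < η) {εU : ℝ} (hεU : 0 ≤ εU)
  {c₁ : ℝ} [Fact (0 < c₁)] (hc : c₁ = (L : ℝ) ^ (d + 1) * c₀) {a' : ℝ} (ha' : 0 < a') (hηL : η * L = 1)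

include hφ hφ' hMφ hMφ' hη hεU hc ha' hηL in
/-- **`P(U) = 1 − R(U)` DECAYS BETWEEN THE FINE SITE BLOCKS AT EVERY BACKGROUND OF THE WINDOW, κ₁-FREE, UNIFORM IN THE VOLUME AND IN `U`** — the
sites → sites twin of `B9Eq349DPBlockDecayWindow.exists_block_decay_DP_window` (same scalar letters and windows; the chain's last step is (S3f)'s
`norm_block_comp_oneSubR_comp_block_le` instead of `norm_bondBlock_comp_DP_comp_block_le`, so NO `D_U` factor: `C = (C_GM_Q)·C_c·(M_QC_G)·K_{d+1}(κ∕8)²`):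
`∃ C ≥ 0, ∀ m, ∀ U (U ∈ U1, ‖U − 1‖ ≤ ε_U, hRS), ∀ P^S, ∀ y₀ y₁: ‖P^S_{y₁} ∘ (1 − R(U)) ∘ P^S_{y₀}‖ ≤ C·e^{−(κ∕8)·d_m(y₀,y₁)}` — the `hdec` letter of
ne9-leaf-05's (K6T) `B9Eq389CutoffTailFromBlockDecay.norm_mul_apply_le_of_block_decay` at a background (their W-4, journal 2026-08-23 l.53479).
[cite: Balaban1985BackgroundPropagators, (3.25)–(3.26) pp.394–395, Thm 3.11 p.416, (3.49) p.399; Balaban1984PropagatorsI, p.38] -/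
theorem exists_block_decay_oneSubR_window {γ β r ℓ ℓ' K κb κ Pw s cΔ CG e : ℝ} (hγ : 0 < γ) (hβ : 0 ≤ β) (hr : 0 ≤ r)
    (hγc : γ ≤ 1 / (2 + 2 / a') -
        (Real.sqrt ((d + 1 : ℕ) : ℝ) * (‖((η : ℂ))⁻¹‖ * (2 * Mφ * Mφ' * εU)) + (Real.sqrt ((d + 1 : ℕ) : ℝ) * (‖((η : ℂ))⁻¹‖ * (2 * Mφ * Mφ' * εU))) ^ 2 +
          a' * (((1 + 2 * Mφ * Mφ' * εU) ^ ((d + 1) * (L - 1)) - 1)) * (2 + ((1 + 2 * Mφ * Mφ' * εU) ^ ((d + 1) * (L - 1)) - 1))))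
    (hℓ : 1 ≤ ℓ) (hℓ' : 1 ≤ ℓ') (hwin : r * ℓ * η ≤ 1) (hwin' : r * ℓ' ≤ 1)
    (hβD : 2 * r * ℓ * (Mφ * Mφ') * Real.sqrt ((d + 1 : ℕ) : ℝ) ≤ β) (hβQ : 2 * r * ℓ' * (1 + 2 * Mφ * Mφ' * εU) ^ ((d + 1) * (L - 1)) ≤ β)
    (small : 3 * (1 + a') * β ^ 2 ≤ γ / 4)
    (hK : 0 ≤ K) (hκ : 0 < κ) (hκr : κ ≤ r) (hκb : κ ≤ κb)
    (hb : ∀ (m : Fin (d + 1) → ℕ) [∀ i, NeZero (m i)] (y y' : TSite (d + 1) m),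
      ‖torusKernel145M L (a' * (η * L) ^ 2 * (c₁ / (c₀ * (L : ℝ) ^ (d + 1)))) m (liftSite y - liftSite y')‖ ≤ K * Real.exp (-(κb * tdist m y y')))
    (hPw : Pw = (1 + 2 * Mφ * Mφ' * εU) ^ ((d + 1) * (L - 1))) (hs : s = Real.sqrt (c₁ / (c₀ * (L : ℝ) ^ (d + 1))))
    (hcΔ : cΔ = 2 * (2 + 2 * Mφ * Mφ' * εU) * ‖((η : ℂ))⁻¹‖ ^ 2 * ((d + 1 : ℕ) : ℝ) * (2 * Mφ * Mφ' * εU) +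
        |a'| * (((1 + 2 * Mφ * Mφ' * εU) ^ ((d + 1) * (L - 1)) + 1) * ((1 + 2 * Mφ * Mφ' * εU) ^ ((d + 1) * (L - 1)) - 1) *
          (c₁ / (c₀ * (L : ℝ) ^ (d + 1)))))
    (hCG : CG = 4 / γ * Real.exp r)
    (he : e = 2 * (Pw * s) * CG * (((Pw - 1) * s) * CG + (Pw * s) * (CG * (cΔ * Real.exp (κ * 1)) * CG * latticeConst (d + 1) (κ - κ / 2) ^ 2)) *
      latticeConst (d + 1) (κ - κ / 2))
    (hq : (c₀ / c₁ * ((η * L) ^ 2 * (c₁ / (c₀ * (L : ℝ) ^ (d + 1)))) ^ 2 * (L : ℝ) ^ (d + 1))⁻¹ * K * e *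
      latticeConst (d + 1) (κ / 2 - κ / 4) ^ 2 < 1) :
    ∃ C : ℝ, 0 ≤ C ∧ ∀ (m : Fin (d + 1) → ℕ) [∀ i, NeZero (m i)] [∀ i, NeZero (fineP L m i)]
      (U : Bond (d + 1) (fineP L m) → 𝔸ˣ) (_hU : ∀ b, U b ∈ U1 𝔸) (_hUε : ∀ b, ‖(U b : 𝔸) - 1‖ ≤ εU)
      (_hRS : ∀ (b : Bond (d + 1) (fineP L m)) (v u : W), ⟪adTransportW φ U b v, u⟫_ℂ = ⟪v, adTransportW φ (fun b => (U b)⁻¹) b u⟫_ℂ)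
      (PS : TSite (d + 1) m → SiteL2K ℂ (d + 1) (fineP L m) c₀ W →L[ℂ] SiteL2K ℂ (d + 1) (fineP L m) c₀ W)
      (_hPS : ∀ (y : TSite (d + 1) m) (f : SiteL2K ℂ (d + 1) (fineP L m) c₀ W) (x : TSite (d + 1) (fineP L m)),
        WL2.equiv ℂ (fun _ : TSite (d + 1) (fineP L m) => c₀) W (PS y f) x =
          if blockCoord L m x = y then WL2.equiv ℂ (fun _ : TSite (d + 1) (fineP L m) => c₀) W f x else 0)
      (y₀ y₁ : TSite (d + 1) m),
      ‖PS y₁ ∘L LinearMap.toContinuousLinearMap (LinearMap.id - RofU L m φ η U (c₀ := c₀)) ∘L PS y₀‖ ≤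
        C * Real.exp (-(κ / 8 * tdist m y₀ y₁)) := by
  have hc₀ : 0 < c₀ := Fact.out
  have hc₁ : 0 < c₁ := Fact.out
  have hL : 1 ≤ L := Nat.one_le_iff_ne_zero.mpr (NeZero.ne L)
  have hLr : (0 : ℝ) < (L : ℝ) ^ (d + 1) := pow_pos (by exact_mod_cast Nat.pos_of_ne_zero (NeZero.ne L)) _
  have hεR : 0 ≤ 2 * Mφ * Mφ' * εU := by positivity
  have hPw1 : 1 ≤ Pw := by rw [hPw]; exact one_le_pow₀ (by linarith)
  have hPw0 : 0 ≤ Pw := zero_le_one.trans hPw1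
  have hPsub : 0 ≤ Pw - 1 := sub_nonneg.mpr hPw1
  have hs0 : 0 ≤ s := by rw [hs]; exact Real.sqrt_nonneg _
  have hP1' : 0 ≤ (1 + 2 * Mφ * Mφ' * εU) ^ ((d + 1) * (L - 1)) - 1 := by rw [← hPw]; exact hPsub
  have hcΔ0 : 0 ≤ cΔ := by rw [hcΔ]; positivity
  have hCG0 : 0 ≤ CG := by rw [hCG]; positivity
  have hK2 : 0 ≤ latticeConst (d + 1) (κ - κ / 2) := latticeConst_nonneg _ (by linarith)
  have hK4 : 0 ≤ latticeConst (d + 1) (κ / 2 - κ / 4) := latticeConst_nonneg _ (by linarith)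
  have hK8 : 0 ≤ latticeConst (d + 1) (κ / 4 - κ / 8) := latticeConst_nonneg _ (by linarith)
  have he0 : 0 ≤ e := by rw [he]; positivity
  set σi : ℝ := (c₀ / c₁ * ((η * L) ^ 2 * (c₁ / (c₀ * (L : ℝ) ^ (d + 1)))) ^ 2 * (L : ℝ) ^ (d + 1))⁻¹ with hσi
  have hσi0 : 0 ≤ σi := by positivity
  have hq1 : 0 < 1 - σi * K * e * latticeConst (d + 1) (κ / 2 - κ / 4) ^ 2 := sub_pos.mpr hq
  -- the constant: (C_G M_Q) · C_c · (M_Q C_G) · K_{d+1}(κ∕8)²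
  set Cc : ℝ := σi * K / (1 - σi * K * e * latticeConst (d + 1) (κ / 2 - κ / 4) ^ 2) with hCc
  have hCc0 : 0 ≤ Cc := div_nonneg (mul_nonneg hσi0 hK) hq1.le
  set CT : ℝ := (CG * ((1 + 2 * Mφ * Mφ' * εU) ^ ((d + 1) * (L - 1)) * Real.sqrt (c₁ / (c₀ * (L : ℝ) ^ (d + 1))))) * Cc *
    ((1 + 2 * Mφ * Mφ' * εU) ^ ((d + 1) * (L - 1)) * Real.sqrt (c₁ / (c₀ * (L : ℝ) ^ (d + 1))) * CG) * latticeConst (d + 1) (κ / 4 - κ / 8) ^ 2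
    with hCT
  refine ⟨CT, by positivity, fun m _ _ U hU hUε hRS PS hPS y₀ y₁ => ?_⟩
  classical
  have hm : ∀ i, 1 ≤ m i := fun i => Nat.one_le_iff_ne_zero.mpr (NeZero.ne (m i))
  -- the coarse point family and the positivity witnesses
  obtain ⟨rr, hrr⟩ := exists_block_clm_family (𝕜 := ℂ) (w := fun _ : TSite (d + 1) m => c₁) (V := W) (fun z : TSite (d + 1) m => z)
  have hRS1 := hRS_one L m φ (𝔸 := 𝔸)
  have hposU : ∀ x : SiteL2K ℂ (d + 1) (fineP L m) c₀ W, x ≠ 0 → 0 < RCLike.re ⟪x, laplacePrimeA L m φ η U a' (c₁ := c₁) x⟫_ℂ :=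
    fun x hx => laplacePrimeA_pos_of_hRS L m φ η U a' hη.ne' ha' hRS x hx
  have hpos1 : ∀ x : SiteL2K ℂ (d + 1) (fineP L m) c₀ W, x ≠ 0 →
      0 < RCLike.re ⟪x, laplacePrimeA L m φ η (fun _ : Bond (d + 1) (fineP L m) => (1 : 𝔸ˣ)) a' (c₁ := c₁) x⟫_ℂ :=
    fun x hx => laplacePrimeA_pos_of_hRS L m φ η (fun _ : Bond (d + 1) (fineP L m) => (1 : 𝔸ˣ)) a' hη.ne' ha' hRS1 x hx
  have hXU := QGGQ_pos L m φ c₀ η U c₁ a' hRS hposU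
  have hX1 := QGGQ_pos L m φ c₀ η (fun _ : Bond (d + 1) (fineP L m) => (1 : 𝔸ˣ)) c₁ a' hRS1 hpos1
  have hU1 : ∀ _b : Bond (d + 1) (fineP L m), (1 : 𝔸ˣ) ∈ U1 𝔸 := fun _ => (U1 𝔸).one_mem
  have hUε1 : ∀ _b : Bond (d + 1) (fineP L m), ‖((1 : 𝔸ˣ) : 𝔸) - 1‖ ≤ εU := fun _ => by rw [Units.val_one, sub_self, norm_zero]; exact hεU
  -- §1: the two `G′`-letters at rate `r`, weakened to `κ` and to `κ∕4`
  have hGU : ∀ z₀ z₁, ‖PS z₁ ∘L LinearMap.toContinuousLinearMap (GpOfU L m φ η U a' (c₁ := c₁) hposU) ∘L PS z₀‖ ≤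
      CG * Real.exp (-(r * tdist m z₀ z₁)) := fun z₀ z₁ => by
    rw [hCG]
    exact norm_block_comp_GpOfU_comp_block_le_circle hφ hφ' hMφ hMφ' hη hU hεU hUε hc ha' hRS hηL hposU hPS hγ hβ hr hγc hℓ hℓ' hwin hwin'
      hβD hβQ small hm z₀ z₁
  have hG1 : ∀ z₀ z₁, ‖PS z₁ ∘L LinearMap.toContinuousLinearMap
      (GpOfU L m φ η (fun _ : Bond (d + 1) (fineP L m) => (1 : 𝔸ˣ)) a' (c₁ := c₁) hpos1) ∘L PS z₀‖ ≤ CG * Real.exp (-(r * tdist m z₀ z₁)) :=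
    fun z₀ z₁ => by
    rw [hCG]
    exact norm_block_comp_GpOfU_comp_block_le_circle hφ hφ' hMφ hMφ' hη hU1 hεU hUε1 hc ha' hRS1 hηL hpos1 hPS hγ hβ hr hγc hℓ hℓ' hwin hwin'
      hβD hβQ small hm z₀ z₁
  have hGUκ : ∀ z₀ z₁, ‖PS z₁ ∘L LinearMap.toContinuousLinearMap (GpOfU L m φ η U a' (c₁ := c₁) hposU) ∘L PS z₀‖ ≤
      CG * Real.exp (-(κ * tdist m z₀ z₁)) := fun z₀ z₁ => decay_mono_rate hCG0 hκr (tdist_nonneg m z₀ z₁) (hGU z₀ z₁)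
  have hG1κ : ∀ z₀ z₁, ‖PS z₁ ∘L LinearMap.toContinuousLinearMap
      (GpOfU L m φ η (fun _ : Bond (d + 1) (fineP L m) => (1 : 𝔸ˣ)) a' (c₁ := c₁) hpos1) ∘L PS z₀‖ ≤ CG * Real.exp (-(κ * tdist m z₀ z₁)) :=
    fun z₀ z₁ => decay_mono_rate hCG0 hκr (tdist_nonneg m z₀ z₁) (hG1 z₀ z₁)
  have hGU4 : ∀ z₀ z₁, ‖PS z₁ ∘L LinearMap.toContinuousLinearMap (GpOfU L m φ η U a' (c₁ := c₁) hposU) ∘L PS z₀‖ ≤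
      CG * Real.exp (-(κ / 4 * tdist m z₀ z₁)) := fun z₀ z₁ => decay_mono_rate hCG0 (by linarith) (tdist_nonneg m z₀ z₁) (hGUκ z₀ z₁)
  -- `G′(U) − G′(1)` at rate `κ∕2` (B9Eq349GreenPerturbedBlockDecay §1)
  have hΔd := norm_block_comp_GpOfU_sub_flat_comp_block_le hPS hφ hφ' hMφ hMφ' hU hεU hUε hRS hm hposU hpos1 hCG0 (by linarith : 0 ≤ κ / 2)
    (by linarith : κ / 2 < κ) hGUκ hG1κ
  -- the `E`-letter `hEd` at rate `κ∕2` ((S3b) with (S3e-Q)'s eight `Q`-letters)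
  have hEd := norm_block_QGGQ_sub_le_torus hm PS (sum_block_apply hPS) (block_comp_self hPS) rr
    (LinearMap.toContinuousLinearMap ((WL2.linearEquiv ℂ ℂ (fun _ : TSite (d + 1) m => c₁)).symm.toLinearMap ∘ₗ QprimeW L m φ U (c₀ := c₀)))
    (LinearMap.toContinuousLinearMap ((WL2.linearEquiv ℂ ℂ (fun _ : TSite (d + 1) m => c₁)).symm.toLinearMap ∘ₗ
      QprimeW L m φ (fun _ : Bond (d + 1) (fineP L m) => (1 : 𝔸ˣ)) (c₀ := c₀)))
    (ContinuousLinearMap.adjoint (LinearMap.toContinuousLinearMap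
      ((WL2.linearEquiv ℂ ℂ (fun _ : TSite (d + 1) m => c₁)).symm.toLinearMap ∘ₗ QprimeW L m φ U (c₀ := c₀))))
    (ContinuousLinearMap.adjoint (LinearMap.toContinuousLinearMap
      ((WL2.linearEquiv ℂ ℂ (fun _ : TSite (d + 1) m => c₁)).symm.toLinearMap ∘ₗ
        QprimeW L m φ (fun _ : Bond (d + 1) (fineP L m) => (1 : 𝔸ˣ)) (c₀ := c₀))))
    (LinearMap.toContinuousLinearMap (GpOfU L m φ η U a' (c₁ := c₁) hposU))
    (LinearMap.toContinuousLinearMap (GpOfU L m φ η (fun _ : Bond (d + 1) (fineP L m) => (1 : 𝔸ˣ)) a' (c₁ := c₁) hpos1))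
    (MQ := Pw * s) (βQ := (Pw - 1) * s) (by positivity) (by positivity) hCG0 (by positivity : 0 ≤ CG * (cΔ * Real.exp (κ * 1)) * CG *
      latticeConst (d + 1) (κ - κ / 2) ^ 2) (by linarith : 0 ≤ κ / 2) (by linarith : κ / 2 < κ)
    (fun z y hz => point_comp_Qtilde_comp_block_eq_zero hrr hPS U (Ne.symm hz))
    (fun z y hz => point_comp_Qtilde_comp_block_eq_zero hrr hPS _ (Ne.symm hz))
    (fun y => by rw [hPw, hs]; exact norm_point_comp_Qtilde_comp_block_le hrr hPS hφ hφ' hMφ hMφ' hU1 hεU hUε1 y y)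
    (fun y => by rw [hPw, hs]; exact norm_point_comp_Qtilde_sub_comp_block_le hrr hPS hφ hφ' hMφ hMφ' hU hεU hUε y y)
    (fun y z hz => block_comp_adjoint_Qtilde_comp_point_eq_zero hrr hPS U (Ne.symm hz))
    (fun y z hz => block_comp_adjoint_Qtilde_comp_point_eq_zero hrr hPS _ (Ne.symm hz))
    (fun y => norm_block_comp_adjoint_comp_point_le hrr hPS _ y y
      (by rw [hPw, hs]; exact norm_point_comp_Qtilde_comp_block_le hrr hPS hφ hφ' hMφ hMφ' hU hεU hUε y y))
    (fun y => by
      rw [← map_sub]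
      exact norm_block_comp_adjoint_comp_point_le hrr hPS _ y y
        (by rw [hPw, hs]; exact norm_point_comp_Qtilde_sub_comp_block_le hrr hPS hφ hφ' hMφ hMφ' hU hεU hUε y y))
    hGUκ hG1κ (fun z₀ z₁ => by rw [hcΔ]; exact hΔd z₀ z₁)
  -- the flat kernel letter at `κ∕2`, then (S3d): `c(U)` at `κ∕4`
  have hb2 : ∀ y y' : TSite (d + 1) m, ‖torusKernel145M L (a' * (η * L) ^ 2 * (c₁ / (c₀ * (L : ℝ) ^ (d + 1)))) m (liftSite y - liftSite y')‖ ≤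
      K * Real.exp (-(κ / 2 * tdist m y y')) := fun y y' => decay_mono_rate hK (by linarith) (tdist_nonneg m y y') (hb m y y')
  have hcd := norm_point_block_greenK_le_of_window L m φ c₀ η c₁ hη.ne' ha' U hpos1 hX1 hposU hXU hrr hK he0 (by linarith : 0 ≤ κ / 4)
    (by linarith : κ / 4 < κ / 2) hb2 (fun z₀ z₁ => by
      rw [he]
      have h := hEd z₀ z₁
      exact le_of_eq_of_le (by congr 1) h) hq
  -- (S3f): `1 − R(U)` at `κ∕8`
  exact norm_block_comp_oneSubR_comp_block_le hPS hrr hφ hφ' hMφ hMφ' hU hεU hUε hRS hposU hm hXU hCG0 hCc0 (by linarith : 0 ≤ κ / 8)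
    (by linarith : κ / 8 < κ / 4) hGU4 hcd y₀ y₁


end Window
/-! ## §2 `∃ ε₀ > 0` first: every sufficiently flat background; §3 the junction into (K6T) -/

section Small
variable {d : ℕ} (L : ℕ) [NeZero L] {𝔸 : Type*} [NormedRing 𝔸] [NormedAlgebra ℂ 𝔸] [NormOneClass 𝔸]
  {W : Type*} [NormedAddCommGroup W] [InnerProductSpace ℂ W] [FiniteDimensional ℂ W] (φ : W ≃ₗ[ℂ] 𝔸) {Mφ Mφ' : ℝ}
  (hφ : ∀ w, ‖φ w‖ ≤ Mφ * ‖w‖) (hφ' : ∀ X, ‖φ.symm X‖ ≤ Mφ' * ‖X‖) (hMφ : 0 ≤ Mφ) (hMφ' : 0 ≤ Mφ')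
  (c₀ : ℝ) [Fact (0 < c₀)] (η : ℝ) (hη : 0 < η) (c₁ : ℝ) [Fact (0 < c₁)] (hc : c₁ = (L : ℝ) ^ (d + 1) * c₀) (a' : ℝ) (ha' : 0 < a')
  (hηL : η * L = 1)

/-- a real function continuous at `0` with value `< u` there is `< u` on a neighbourhood `|ε| < δ`. [folklore] -/
private theorem exists_delta_lt' {f : ℝ → ℝ} (hf : Continuous f) {u : ℝ} (h0 : f 0 < u) : ∃ δ : ℝ, 0 < δ ∧ ∀ ε : ℝ, |ε| < δ → f ε < u := by
  have hev : ∀ᶠ ε in 𝓝 (0 : ℝ), f ε < u := (hf.tendsto 0).eventually (eventually_lt_nhds h0)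
  obtain ⟨δ, hδ, hball⟩ := Metric.eventually_nhds_iff.mp hev
  exact ⟨δ, hδ, fun ε hε => hball (by rwa [Real.dist_eq, sub_zero])⟩

include hφ hφ' hMφ hMφ' hη hc ha' hηL in
/-- **`1 − R(U)` DECAYS BETWEEN THE FINE SITE BLOCKS FOR EVERY SUFFICIENTLY FLAT BACKGROUND — `∃ ε₀ > 0` FIRST**: given the structure letters and the
fibre identification, `∃ ε₀ > 0, κ > 0, C ≥ 0` (BEFORE the volume and the background) with `‖P^S_{y₁} ∘ (1 − R(U)) ∘ P^S_{y₀}‖ ≤ C·e^{−κ·d_m(y₀,y₁)}` for every volume, every `U ∈ U1` with `‖U − 1‖ ≤ ε₀` and `hRS`, every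
fine block family — §1 with ne9-leaf-06's `exists_flatc_bound` and the continuity-at-`0` choice of `ε₀` of `B9Eq349KWAssemblySmallField` (same letters
`γ, β, r, κ`); the `hdec` input of ne9-leaf-05's (β) junction with NOTHING displayed. [cite: Balaban1985BackgroundPropagators, Thm 3.11 p.416, (3.49) p.399, (3.25) p.394] -/
theorem exists_oneSubR_decay_of_small_background :
    ∃ ε₀ κ C : ℝ, 0 < ε₀ ∧ 0 < κ ∧ 0 ≤ C ∧ ∀ (m : Fin (d + 1) → ℕ) [∀ i, NeZero (m i)] [∀ i, NeZero (fineP L m i)]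
      (U : Bond (d + 1) (fineP L m) → 𝔸ˣ) (_hU : ∀ b, U b ∈ U1 𝔸) (_hUε : ∀ b, ‖(U b : 𝔸) - 1‖ ≤ ε₀)
      (_hRS : ∀ (b : Bond (d + 1) (fineP L m)) (v u : W), ⟪adTransportW φ U b v, u⟫_ℂ = ⟪v, adTransportW φ (fun b => (U b)⁻¹) b u⟫_ℂ)
      (PS : TSite (d + 1) m → SiteL2K ℂ (d + 1) (fineP L m) c₀ W →L[ℂ] SiteL2K ℂ (d + 1) (fineP L m) c₀ W)
      (_hPS : ∀ (y : TSite (d + 1) m) (f : SiteL2K ℂ (d + 1) (fineP L m) c₀ W) (x : TSite (d + 1) (fineP L m)),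
        WL2.equiv ℂ (fun _ : TSite (d + 1) (fineP L m) => c₀) W (PS y f) x =
          if blockCoord L m x = y then WL2.equiv ℂ (fun _ : TSite (d + 1) (fineP L m) => c₀) W f x else 0)
      (y₀ y₁ : TSite (d + 1) m),
      ‖PS y₁ ∘L LinearMap.toContinuousLinearMap (LinearMap.id - RofU L m φ η U (c₀ := c₀)) ∘L PS y₀‖ ≤ C * Real.exp (-(κ * tdist m y₀ y₁)) := by
  have hc₀ : 0 < c₀ := Fact.out
  have hc₁ : 0 < c₁ := Fact.out
  have hL1 : (1 : ℝ) ≤ L := by exact_mod_cast Nat.one_le_iff_ne_zero.mpr (NeZero.ne L)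
  have hLr : (0 : ℝ) < (L : ℝ) ^ (d + 1) := by positivity
  have hMM : 0 ≤ 2 * Mφ * Mφ' := by positivity
  -- the flat kernel letter of `c(1)`, uniform in the volume (ne9-leaf-06)
  have ha₀ : 0 < a' * (η * L) ^ 2 * (c₁ / (c₀ * (L : ℝ) ^ (d + 1))) := by rw [hηL]; positivity
  obtain ⟨κb, K, hκb, hK, hbb⟩ := exists_flatc_bound (d := d) (a' * (η * L) ^ 2 * (c₁ / (c₀ * (L : ℝ) ^ (d + 1))))
    (a' * (η * L) ^ 2 * (c₁ / (c₀ * (L : ℝ) ^ (d + 1)))) ha₀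
  -- the scalar choices `γ, β, r, κ` (fresh letters with their defining equations)
  obtain ⟨γ, hγdef⟩ : ∃ γ : ℝ, γ = 1 / (2 * (2 + 2 / a')) := ⟨_, rfl⟩
  have hA0 : (0 : ℝ) < 2 + 2 / a' := by positivity
  have hγ : 0 < γ := by rw [hγdef]; positivity
  have hγA : 1 / (2 + 2 / a') = 2 * γ := by rw [hγdef]; field_simp
  obtain ⟨β, hβdef⟩ : ∃ β : ℝ, β = min 1 (γ / (12 * (1 + a'))) := ⟨_, rfl⟩
  have hβ0 : 0 < β := by rw [hβdef]; exact lt_min one_pos (by positivity)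
  have hβ1 : β ≤ 1 := by rw [hβdef]; exact min_le_left _ _
  have small : 3 * (1 + a') * β ^ 2 ≤ γ / 4 := by
    have h2 : β ≤ γ / (12 * (1 + a')) := by rw [hβdef]; exact min_le_right _ _
    have h3 : 3 * (1 + a') * β ≤ γ / 4 := by
      calc 3 * (1 + a') * β ≤ 3 * (1 + a') * (γ / (12 * (1 + a'))) := mul_le_mul_of_nonneg_left h2 (by positivity)
        _ = γ / 4 := by field_simp; ring
    calc 3 * (1 + a') * β ^ 2 = 3 * (1 + a') * β * β := by ring
      _ ≤ γ / 4 * 1 := mul_le_mul h3 hβ1 hβ0.le (by positivity)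
      _ = γ / 4 := mul_one _
  obtain ⟨P₁, hP₁⟩ : ∃ P₁ : ℝ, P₁ = (1 + 2 * Mφ * Mφ' * 1) ^ ((d + 1) * (L - 1)) := ⟨_, rfl⟩
  have hP₁1 : 1 ≤ P₁ := by rw [hP₁]; exact one_le_pow₀ (by linarith)
  have hP₁0 : 0 < P₁ := by linarith
  obtain ⟨r, hrdef⟩ : ∃ r : ℝ, r = min 1 (min (β / (2 * (Mφ * Mφ') * Real.sqrt ((d + 1 : ℕ) : ℝ) + 1)) (β / (2 * P₁))) := ⟨_, rfl⟩
  have hr0 : 0 < r := by rw [hrdef]; exact lt_min one_pos (lt_min (by positivity) (by positivity))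
  have hr1 : r ≤ 1 := by rw [hrdef]; exact min_le_left _ _
  have hrD : r ≤ β / (2 * (Mφ * Mφ') * Real.sqrt ((d + 1 : ℕ) : ℝ) + 1) := by rw [hrdef]; exact (min_le_right _ _).trans (min_le_left _ _)
  have hrP : r ≤ β / (2 * P₁) := by rw [hrdef]; exact (min_le_right _ _).trans (min_le_right _ _)
  obtain ⟨κ, hκdef⟩ : ∃ κ : ℝ, κ = min r κb := ⟨_, rfl⟩
  have hκ0 : 0 < κ := by rw [hκdef]; exact lt_min hr0 hκb
  have hκr : κ ≤ r := by rw [hκdef]; exact min_le_left _ _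
  have hκb' : κ ≤ κb := by rw [hκdef]; exact min_le_right _ _
  have hη1 : η ≤ 1 := by
    have : η = 1 / L := by rw [← hηL]; field_simp
    rw [this]; exact (div_le_one (by linarith)).mpr hL1
  obtain ⟨CG, hCGdef⟩ : ∃ CG : ℝ, CG = 4 / γ * Real.exp r := ⟨_, rfl⟩
  obtain ⟨sC, hsC⟩ : ∃ sC : ℝ, sC = Real.sqrt (c₁ / (c₀ * (L : ℝ) ^ (d + 1))) := ⟨_, rfl⟩
  -- the window functions of `ε` (fresh letters) and their continuity at `0`
  obtain ⟨Pf, hPf⟩ : ∃ Pf : ℝ → ℝ, Pf = fun ε => (1 + 2 * Mφ * Mφ' * ε) ^ ((d + 1) * (L - 1)) := ⟨_, rfl⟩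
  have hPfc : Continuous Pf := by rw [hPf]; fun_prop
  have hPf0 : Pf 0 = 1 := by rw [hPf]; simp
  obtain ⟨ff, hff⟩ : ∃ ff : ℝ → ℝ, ff = fun ε => Real.sqrt ((d + 1 : ℕ) : ℝ) * (‖((η : ℂ))⁻¹‖ * (2 * Mφ * Mφ' * ε)) +
      (Real.sqrt ((d + 1 : ℕ) : ℝ) * (‖((η : ℂ))⁻¹‖ * (2 * Mφ * Mφ' * ε))) ^ 2 + a' * ((Pf ε - 1) * (2 + (Pf ε - 1))) := ⟨_, rfl⟩
  have hffc : Continuous ff := by rw [hff]; fun_prop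
  have hff0 : ff 0 < γ := by rw [hff]; simp [hPf0, hγ]
  obtain ⟨δ₁, hδ₁, hf1⟩ := exists_delta_lt' hffc hff0
  obtain ⟨cΔf, hcΔf⟩ : ∃ cΔf : ℝ → ℝ, cΔf = fun ε => 2 * (2 + 2 * Mφ * Mφ' * ε) * ‖((η : ℂ))⁻¹‖ ^ 2 * ((d + 1 : ℕ) : ℝ) * (2 * Mφ * Mφ' * ε) +
      |a'| * ((Pf ε + 1) * (Pf ε - 1) * (c₁ / (c₀ * (L : ℝ) ^ (d + 1)))) := ⟨_, rfl⟩
  have hcΔfc : Continuous cΔf := by rw [hcΔf]; fun_prop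
  have hcΔf0 : cΔf 0 = 0 := by rw [hcΔf]; simp [hPf0]
  obtain ⟨ef, hef⟩ : ∃ ef : ℝ → ℝ, ef = fun ε => 2 * (Pf ε * sC) * CG * (((Pf ε - 1) * sC) * CG +
      (Pf ε * sC) * (CG * (cΔf ε * Real.exp (κ * 1)) * CG * latticeConst (d + 1) (κ - κ / 2) ^ 2)) * latticeConst (d + 1) (κ - κ / 2) := ⟨_, rfl⟩
  have hefc : Continuous ef := by rw [hef]; fun_prop
  have hef0 : ef 0 = 0 := by rw [hef]; simp [hPf0, hcΔf0]
  obtain ⟨qf, hqf⟩ : ∃ qf : ℝ → ℝ, qf = fun ε => (c₀ / c₁ * ((η * L) ^ 2 * (c₁ / (c₀ * (L : ℝ) ^ (d + 1)))) ^ 2 * (L : ℝ) ^ (d + 1))⁻¹ * K * ef ε *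
      latticeConst (d + 1) (κ / 2 - κ / 4) ^ 2 := ⟨_, rfl⟩
  have hqfc : Continuous qf := by rw [hqf]; fun_prop
  have hqf0 : qf 0 < 1 := by rw [hqf]; simp [hef0]
  obtain ⟨δ₂, hδ₂, hq2⟩ := exists_delta_lt' hqfc hqf0
  -- the smallness letter
  obtain ⟨ε₀, hε₀def⟩ : ∃ ε₀ : ℝ, ε₀ = min 1 (min (δ₁ / 2) (δ₂ / 2)) := ⟨_, rfl⟩
  have hε₀ : 0 < ε₀ := by rw [hε₀def]; exact lt_min one_pos (lt_min (by positivity) (by positivity))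
  have hε₀1 : ε₀ ≤ 1 := by rw [hε₀def]; exact min_le_left _ _
  have hε₀δ₁ : |ε₀| < δ₁ := by
    rw [abs_of_pos hε₀, hε₀def]; exact ((min_le_right _ _).trans (min_le_left _ _)).trans_lt (half_lt_self hδ₁)
  have hε₀δ₂ : |ε₀| < δ₂ := by
    rw [abs_of_pos hε₀, hε₀def]; exact ((min_le_right _ _).trans (min_le_right _ _)).trans_lt (half_lt_self hδ₂)
  -- the windows at `ε₀`
  have hPfε : Pf ε₀ = (1 + 2 * Mφ * Mφ' * ε₀) ^ ((d + 1) * (L - 1)) := by rw [hPf]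
  have hγc : γ ≤ 1 / (2 + 2 / a') -
      (Real.sqrt ((d + 1 : ℕ) : ℝ) * (‖((η : ℂ))⁻¹‖ * (2 * Mφ * Mφ' * ε₀)) + (Real.sqrt ((d + 1 : ℕ) : ℝ) * (‖((η : ℂ))⁻¹‖ * (2 * Mφ * Mφ' * ε₀))) ^ 2 +
        a' * (((1 + 2 * Mφ * Mφ' * ε₀) ^ ((d + 1) * (L - 1)) - 1)) * (2 + ((1 + 2 * Mφ * Mφ' * ε₀) ^ ((d + 1) * (L - 1)) - 1))) := by
    have h := (hf1 ε₀ hε₀δ₁).le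
    rw [hff] at h
    simp only [hPfε] at h
    rw [hγA]
    linarith only [h]
  have hPε : (1 + 2 * Mφ * Mφ' * ε₀) ^ ((d + 1) * (L - 1)) ≤ P₁ := by
    rw [hP₁]
    gcongr
  have hwin : r * 1 * η ≤ 1 := by
    have h := mul_le_mul hr1 hη1 hη.le zero_le_one
    rw [mul_one] at h ⊢
    exact h
  have hwin' : r * 1 ≤ 1 := by rw [mul_one]; exact hr1
  have hβD : 2 * r * 1 * (Mφ * Mφ') * Real.sqrt ((d + 1 : ℕ) : ℝ) ≤ β := by
    have hden : 0 < 2 * (Mφ * Mφ') * Real.sqrt ((d + 1 : ℕ) : ℝ) + 1 := by positivity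
    calc 2 * r * 1 * (Mφ * Mφ') * Real.sqrt ((d + 1 : ℕ) : ℝ) = r * (2 * (Mφ * Mφ') * Real.sqrt ((d + 1 : ℕ) : ℝ)) := by ring
      _ ≤ r * (2 * (Mφ * Mφ') * Real.sqrt ((d + 1 : ℕ) : ℝ) + 1) :=
          mul_le_mul_of_nonneg_left (le_add_of_nonneg_right zero_le_one) hr0.le
      _ ≤ β := (le_div_iff₀ hden).mp hrD
  have hβQ : 2 * r * 1 * (1 + 2 * Mφ * Mφ' * ε₀) ^ ((d + 1) * (L - 1)) ≤ β := by
    have h1 := (le_div_iff₀ (by positivity : (0 : ℝ) < 2 * P₁)).mp hrP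
    calc 2 * r * 1 * (1 + 2 * Mφ * Mφ' * ε₀) ^ ((d + 1) * (L - 1)) ≤ 2 * r * 1 * P₁ := by gcongr
      _ = r * (2 * P₁) := by ring
      _ ≤ β := h1
  have hcΔε : cΔf ε₀ = 2 * (2 + 2 * Mφ * Mφ' * ε₀) * ‖((η : ℂ))⁻¹‖ ^ 2 * ((d + 1 : ℕ) : ℝ) * (2 * Mφ * Mφ' * ε₀) +
      |a'| * (((1 + 2 * Mφ * Mφ' * ε₀) ^ ((d + 1) * (L - 1)) + 1) * ((1 + 2 * Mφ * Mφ' * ε₀) ^ ((d + 1) * (L - 1)) - 1) *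
        (c₁ / (c₀ * (L : ℝ) ^ (d + 1)))) := by
    rw [hcΔf]; simp only [hPfε]
  have heε : ef ε₀ = 2 * (Pf ε₀ * sC) * CG * (((Pf ε₀ - 1) * sC) * CG +
      (Pf ε₀ * sC) * (CG * (cΔf ε₀ * Real.exp (κ * 1)) * CG * latticeConst (d + 1) (κ - κ / 2) ^ 2)) * latticeConst (d + 1) (κ - κ / 2) := by
    rw [hef]
  have hq : (c₀ / c₁ * ((η * L) ^ 2 * (c₁ / (c₀ * (L : ℝ) ^ (d + 1)))) ^ 2 * (L : ℝ) ^ (d + 1))⁻¹ * K * ef ε₀ *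
      latticeConst (d + 1) (κ / 2 - κ / 4) ^ 2 < 1 := by
    have h := hq2 ε₀ hε₀δ₂
    rw [hqf] at h
    exact h
  -- the window theorem at `ε_U := ε₀`
  obtain ⟨C, hC, H⟩ := exists_block_decay_oneSubR_window (d := d) (L := L) (𝔸 := 𝔸) (W := W) hφ hφ' hMφ hMφ' hη hε₀.le hc ha' hηL hγ hβ0.le
    hr0.le hγc le_rfl le_rfl hwin hwin' hβD hβQ small hK hκ0 hκr hκb'
    (fun m _ y y' => hbb L m _ le_rfl le_rfl y y') hPfε hsC hcΔε hCGdef heε hq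
  refine ⟨ε₀, κ / 8, C, hε₀, by positivity, hC, fun m _ _ U hU hUε hRS PS hPS y₀ y₁ => ?_⟩
  exact H m U hU hUε hRS PS hPS y₀ y₁


include hφ hφ' hMφ hMφ' hη hc ha' hηL in
/-- **THE JUNCTION INTO ne9-leaf-05's (K6T)** — §2's output IS the `hdec` binder of `B9Eq389CutoffTailFromBlockDecay.norm_mul_apply_le_of_block_decay` (by
`exact`): `∃ ε₀ κ C` (before the volume and the background) such that for every `U` of the `ε₀`-window, every fine block family, every pointwise multiplier
`M = μ·` with `|μ| ≤ 1` vanishing on the blocks within `r₀` of `Y₀`, and every `f` supported in the blocks over `Y₀`: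
`‖M((1 − R(U))f)‖ ≤ C·K_{d+1}(κ∕2)·e^{−(κ∕2)r₀}·‖f‖` — S-P6′(β)'s cut-off tail `hτ` at a background. [cite: Balaban1985BackgroundPropagators, (3.89) p.409, (3.49) p.399, Thm 3.11 p.416] -/
theorem exists_cutoffTail_oneSubR_of_small_background :
    ∃ ε₀ κ C : ℝ, 0 < ε₀ ∧ 0 < κ ∧ 0 ≤ C ∧ ∀ (m : Fin (d + 1) → ℕ) [∀ i, NeZero (m i)] [∀ i, NeZero (fineP L m i)]
      (U : Bond (d + 1) (fineP L m) → 𝔸ˣ) (_hU : ∀ b, U b ∈ U1 𝔸) (_hUε : ∀ b, ‖(U b : 𝔸) - 1‖ ≤ ε₀)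
      (_hRS : ∀ (b : Bond (d + 1) (fineP L m)) (v u : W), ⟪adTransportW φ U b v, u⟫_ℂ = ⟪v, adTransportW φ (fun b => (U b)⁻¹) b u⟫_ℂ)
      (PS : TSite (d + 1) m → SiteL2K ℂ (d + 1) (fineP L m) c₀ W →L[ℂ] SiteL2K ℂ (d + 1) (fineP L m) c₀ W)
      (_hPS : ∀ (y : TSite (d + 1) m) (f : SiteL2K ℂ (d + 1) (fineP L m) c₀ W) (x : TSite (d + 1) (fineP L m)),
        WL2.equiv ℂ (fun _ : TSite (d + 1) (fineP L m) => c₀) W (PS y f) x =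
          if blockCoord L m x = y then WL2.equiv ℂ (fun _ : TSite (d + 1) (fineP L m) => c₀) W f x else 0)
      (M : SiteL2K ℂ (d + 1) (fineP L m) c₀ W →L[ℂ] SiteL2K ℂ (d + 1) (fineP L m) c₀ W) (μ : TSite (d + 1) (fineP L m) → ℂ)
      (_hM : ∀ (f : SiteL2K ℂ (d + 1) (fineP L m) c₀ W) (x : TSite (d + 1) (fineP L m)),
        WL2.equiv ℂ (fun _ : TSite (d + 1) (fineP L m) => c₀) W (M f) x = μ x • WL2.equiv ℂ (fun _ : TSite (d + 1) (fineP L m) => c₀) W f x)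
      (_hμ1 : ∀ x, ‖μ x‖ ≤ 1) (Y₀ : Finset (TSite (d + 1) m)) (r₀ : ℝ)
      (_hnear : ∀ x, (∃ y₀ ∈ Y₀, tdist m y₀ (blockCoord L m x) < r₀) → μ x = 0)
      (f : SiteL2K ℂ (d + 1) (fineP L m) c₀ W) (_hf : ∀ x, blockCoord L m x ∉ Y₀ → WL2.equiv ℂ (fun _ : TSite (d + 1) (fineP L m) => c₀) W f x = 0),
      ‖M (LinearMap.toContinuousLinearMap (LinearMap.id - RofU L m φ η U (c₀ := c₀)) f)‖ ≤
        C * latticeConst (d + 1) (κ / 2) * Real.exp (-(κ / 2 * r₀)) * ‖f‖ := by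
  obtain ⟨ε₀, κ, C, hε₀, hκ, hC, H⟩ := exists_oneSubR_decay_of_small_background (d := d) L φ hφ hφ' hMφ hMφ' c₀ η hη c₁ hc a' ha' hηL
  refine ⟨ε₀, κ, C, hε₀, hκ, hC, fun m _ _ U hU hUε hRS PS hPS M μ hM hμ1 Y₀ r₀ hnear f hf => ?_⟩
  have hm : ∀ i, 1 ≤ m i := fun i => Nat.one_le_iff_ne_zero.mpr (NeZero.ne (m i))
  exact norm_mul_apply_le_of_block_decay hPS hM hμ1 hm Y₀ hnear _ hC hκ (H m U hU hUε hRS PS hPS) f hf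

end Small

end Literature.MathematicalPhysics.QuantumFieldTheory.Balaban1983to89.B9Eq349PBlockDecayWindow

end
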